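import Summits.QuantumAdvantage.QuantumAdvantage.Theorems.PerceptronDialLawsE

/-!
# PerceptronDialLaws — REV 6–7 additions (Theorems twin `PerceptronDialLaws.lean` 39366f5d…, 1922 l; cell decomp-qadv, lens-3 g16 «PerceptronDial»;
supports stmt-QuantumAdvantage-27984 LiftA on AnfPresentation).  The rev-5 twin (e8f39841, 1662 l) is in the tree as
`PerceptronDialLawsA/B/C/·/EA/E`; this delta carries, verbatim and in order, everything the refreshed twin ADDS after `end RankCount`:
* §13 `section MatrixLemmaSec` — W₂'s prose/kernel boundary as ONE named statement `MatrixLemma` (ranks of explicit symmetric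
  zero-diagonal 𝔽₂-matrices only) with ★ `rankBound_of_matrixLemma`, `coreBias_of_matrixLemma`, `voteRung2_of_matrixLemma`,
  `card_QParam`, `gaussSum_le_card`, `matrixLemma_lowRange` (critic rows 71v23/71v24);
* §14 `section ChainRule` — the CHAIN RULE for polar matrices `polM_gph : polM (gph P B c) = polM (c0 B) + Jᵀ q J + (Jᵀ q J)ᵀ`,
  Jacobian rows `jm_vs/vt/vB/vp/vc`, `jm_indep`, ★ `polM_gph_indep` (the rank in `RankBound`/`MatrixLemma` is `c`-free).
No `sorry`; standard axioms; no instances, no notation, no unsafe options.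
-/

set_option linter.dupNamespace false

noncomputable section

namespace Summit.QuantumAdvantage.QuantumAdvantage.Theorems.PerceptronDial

open Finset
open Literature.Computability.Complexity
open Literature.Computability.QuantumComplexity
open Literature.Computability.QuantumComplexity.BuzetChailloux (bxor zeroVec)
open Summit.QuantumAdvantage.QuantumAdvantage.Theses.AnfPresentation
  (AnfResidual RungA LiftA NearExactIsExact SignedExactSliceIsLift AnfEquiv)
open Summit.QuantumAdvantage.QuantumAdvantage.Theorems.HintDial
  (IsDualOf forrelation_eq_one_of_isDualOf flipConst value_flipConst rungA_of_anfResidual)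
open Summit.QuantumAdvantage.QuantumAdvantage.Theorems.HintDial.Automaton
  (bd sgl mv MM blTable eval_blTable bd_sgl_left bd_bxor_right dualFn dualFn_append isDualOf_blTable
    bit_bd bit_decide_and signOf_bd mv_bxor mv_eq_iff bxor_left_eq_iff' bd_zeroVec_right)
open Summit.QuantumAdvantage.QuantumAdvantage.Theorems.HintDial (bit_xor bit_and bit_not bit_eq_ite bit_decide_odd bit_injective bit_mul_self bit_false eval_bit)
open CubicForm (bit)
open DerivativeWalsh (W)
open Summit.QuantumAdvantage.QuantumAdvantage.Theorems.PebbleDial (AnfIdx bitsFG bits)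

variable {n k : ℕ}

/-! ## §13 W₂'s prose/kernel boundary as ONE named statement: `MatrixLemma → RankBound` (REV 6; critic row 71v22)

`MatrixLemma` types NODE-g16.md §4.8's MATRIX LEMMA at the kernel interface (i.e. composed with the block formula (A) and the
restriction step (T2) `rank M ≥ rank X`, which is exactly how the paper consumes it): for EVERY size `m` and EVERY quadratic
adversary `P : QuadP (CVar m)`,
  `E_{B,c} 2^{−rank polM(G_{P,B,c})/2} ≤ 200 · 2^{−⌊m/32⌋}`,
written division-free as `2^{⌊m/32⌋} · Σ_{B,c} 2^{2m}/√(2^{rank}) ≤ 200 · |QParam m|` (`|QParam m| = 2^{m²+2m+1}` = #pairs `(B,c)` × `2^{2m}`,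
`card_QParam`).  It speaks of ranks of explicit symmetric zero-diagonal `𝔽₂`-matrices ONLY — no complexity class, no promise problem,
no polynomial `p`, no character sum —; it is trivially true for `m < 256` (`E ≤ 1`; `matrixLemma_lowRange`, kernel) and PAPER-PROVED for
all `m` (§4.8: `≤ max(23·2^{−m/8}, 154·2^{−m/32})`).  `rankBound_of_matrixLemma` is the polynomial-vs-exponential bookkeeping
(`m := 32k` with `400·p(64k) < 2^k`, `BGS.exists_lt_two_pow`).  So W₂ reads
  `MatrixLemma → RankBound → RadBound → CoreBias → KeyBias → VoteRung2NU → VoteRung2`,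
every arrow kernel-checked, and the ONLY prose left under W₂ is the proof of `MatrixLemma` itself. -/

section MatrixLemmaSec

/-- `|QParam m| = 2^{m² + 2m + 1}` -/
theorem card_QParam (m : ℕ) : Fintype.card (QParam m) = 2 ^ (m * m + (m + m) + 1) := by
  simp only [QParam, Fintype.card_prod, Fintype.card_fun, Fintype.card_bool, Fintype.card_fin]
  rw [← pow_mul]
  ring

/-- ★★★ `MatrixLemma` — THE PROSE/KERNEL BOUNDARY OF W₂ (NODE-g16.md §4.8, typed at the kernel interface):
`∀ m, ∀ P, 2^{⌊m/32⌋} · Σ_B Σ_c 2^{2m}/√(2^{rank polM (gph P B c)}) ≤ 200 · |QParam m|`, i.e. `E_{B,c} 2^{−rank M_{P,B,c}/2} ≤ 200·2^{−⌊m/32⌋}`.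
[UNDECIDED in kernel · PAPER-PROVED (§4.8 (A)+(T)+(B′)+(B″)) · pure `𝔽₂` linear algebra · ATTACKABLE (M–L): block formula (S–M), corank tail (T1),
Lemma S̄, isotropic complement] -/
def MatrixLemma : Prop := ∀ m : ℕ, ∀ P : QuadP (CVar m),
  (2 : ℝ) ^ (m / 32) * ∑ B : Fin m → Fin m → Bool, ∑ c : Bool,
      (2 : ℝ) ^ (m + m) / Real.sqrt ((2 : ℝ) ^ (polM (gph P B c)).rank) ≤ 200 * (Fintype.card (QParam m) : ℝ)

/-- each Gauss term is at most `2^{n}` (`rank ≥ 0`) -/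
theorem gaussTerm_le {n : ℕ} (Q : (Fin n → Bool) → Bool) :
    (2 : ℝ) ^ n / Real.sqrt ((2 : ℝ) ^ (polM Q).rank) ≤ (2 : ℝ) ^ n := by
  apply div_le_self (by positivity)
  rw [← Real.sqrt_one]
  exact Real.sqrt_le_sqrt (one_le_pow₀ (by norm_num))

/-- the trivial bound `Σ_{B,c} 2^{2m}/√(2^{rank}) ≤ |QParam m|` (i.e. `E_{B,c} 2^{−rank/2} ≤ 1`) -/
theorem gaussSum_le_card (m : ℕ) (P : QuadP (CVar m)) :
    ∑ B : Fin m → Fin m → Bool, ∑ c : Bool, (2 : ℝ) ^ (m + m) / Real.sqrt ((2 : ℝ) ^ (polM (gph P B c)).rank)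
      ≤ (Fintype.card (QParam m) : ℝ) := by
  have hBc : Fintype.card (Fin m → Fin m → Bool) = 2 ^ (m * m) := by
    rw [Fintype.card_fun, Fintype.card_fun, Fintype.card_bool, Fintype.card_fin, ← pow_mul]
  calc ∑ B : Fin m → Fin m → Bool, ∑ c : Bool, (2 : ℝ) ^ (m + m) / Real.sqrt ((2 : ℝ) ^ (polM (gph P B c)).rank)
      ≤ ∑ B : Fin m → Fin m → Bool, ∑ c : Bool, (2 : ℝ) ^ (m + m) :=
        Finset.sum_le_sum fun B _ => Finset.sum_le_sum fun c _ => gaussTerm_le _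
    _ = (Fintype.card (QParam m) : ℝ) := by
        simp only [Finset.sum_const, Finset.card_univ, Fintype.card_bool, nsmul_eq_mul, hBc, card_QParam]
        push_cast
        ring

/-- SANITY (kernel): `MatrixLemma` holds outright in the low range `m < 256` (there `200·2^{−⌊m/32⌋} ≥ 200/128 > 1 ≥ E`); its content is the
decay for large `m`. -/
theorem matrixLemma_lowRange (m : ℕ) (hm : m < 256) (P : QuadP (CVar m)) :
    (2 : ℝ) ^ (m / 32) * ∑ B : Fin m → Fin m → Bool, ∑ c : Bool,
      (2 : ℝ) ^ (m + m) / Real.sqrt ((2 : ℝ) ^ (polM (gph P B c)).rank) ≤ 200 * (Fintype.card (QParam m) : ℝ) := by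
  have h1 : (2 : ℝ) ^ (m / 32) ≤ (2 : ℝ) ^ 7 := pow_le_pow_right₀ (by norm_num) (by omega)
  have h2 := gaussSum_le_card m P
  have h3 : (0 : ℝ) ≤ ∑ B : Fin m → Fin m → Bool, ∑ c : Bool,
      (2 : ℝ) ^ (m + m) / Real.sqrt ((2 : ℝ) ^ (polM (gph P B c)).rank) := by positivity
  have h4 : (0 : ℝ) ≤ (Fintype.card (QParam m) : ℝ) := by positivity
  calc (2 : ℝ) ^ (m / 32) * ∑ B : Fin m → Fin m → Bool, ∑ c : Bool,
        (2 : ℝ) ^ (m + m) / Real.sqrt ((2 : ℝ) ^ (polM (gph P B c)).rank)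
      ≤ (2 : ℝ) ^ 7 * (Fintype.card (QParam m) : ℝ) := mul_le_mul h1 h2 h3 (by positivity)
    _ ≤ 200 * (Fintype.card (QParam m) : ℝ) := mul_le_mul_of_nonneg_right (by norm_num) h4

/-- ★★ the polynomial-vs-exponential step: `MatrixLemma → RankBound` (`m := 32k` with `400·p(64k) < 2^k`). -/
theorem rankBound_of_matrixLemma : MatrixLemma → RankBound := by
  intro hML p
  obtain ⟨k, -, hk⟩ := BGS.exists_lt_two_pow (400 * p.comp (64 * Polynomial.X) + 1) 0
  have hq : (400 * p.comp (64 * Polynomial.X) + 1).eval k = 400 * p.eval (64 * k) + 1 := by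
    simp [Polynomial.eval_comp]
  rw [hq] at hk
  refine ⟨32 * k, fun P => ?_⟩
  have hML' := hML (32 * k) P
  rw [show 32 * k / 32 = k by omega] at hML'
  have hS0 : (0 : ℝ) ≤ ∑ B : Fin (32 * k) → Fin (32 * k) → Bool, ∑ c : Bool,
      (2 : ℝ) ^ (32 * k + 32 * k) / Real.sqrt ((2 : ℝ) ^ (polM (gph P B c)).rank) := by positivity
  generalize (∑ B : Fin (32 * k) → Fin (32 * k) → Bool, ∑ c : Bool,
      (2 : ℝ) ^ (32 * k + 32 * k) / Real.sqrt ((2 : ℝ) ^ (polM (gph P B c)).rank)) = S at hML' hS0 ⊢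
  have h64 : 32 * k + 32 * k = 64 * k := by ring
  rw [h64]
  have hN : (0 : ℝ) < (Fintype.card (QParam (32 * k)) : ℝ) := by exact_mod_cast Fintype.card_pos
  have hkR : 400 * ((p.eval (64 * k) : ℕ) : ℝ) + 1 < (2 : ℝ) ^ k := by exact_mod_cast hk
  have hp0 : (0 : ℝ) ≤ ((p.eval (64 * k) : ℕ) : ℝ) := by positivity
  have h2k : (0 : ℝ) ≤ (2 : ℝ) ^ k := by positivity
  by_contra hcon
  have hcon' := not_lt.mp hcon
  have h1 := mul_le_mul_of_nonneg_left hcon' h2k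
  have h2 : 2 * ((p.eval (64 * k) : ℕ) : ℝ) * ((2 : ℝ) ^ k * S)
      ≤ 2 * ((p.eval (64 * k) : ℕ) : ℝ) * (200 * (Fintype.card (QParam (32 * k)) : ℝ)) :=
    mul_le_mul_of_nonneg_left hML' (by positivity)
  have h3 := mul_lt_mul_of_pos_right hkR hN
  nlinarith [h1, h2, h3, hN]

/-- hence the whole W₂ chain from the one matrix statement -/
theorem coreBias_of_matrixLemma : MatrixLemma → CoreBias :=
  fun h => coreBias_of_rankBound (rankBound_of_matrixLemma h)

/-- PerceptronDialLawsF helper `voteRung2_of_matrixLemma` (decomp-qadv land package; see the module docstring). -/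
theorem voteRung2_of_matrixLemma : MatrixLemma → VoteRung2 :=
  fun h => voteRung2_of_rankBound (rankBound_of_matrixLemma h)

end MatrixLemmaSec

/-! ## §14 The CHAIN RULE for polar matrices (kernel; structural half of §4.8(A)'s block formula)

For the explicit phase `G_{P,B,c} = c₀_B ⊕ P ∘ ptv_B^c` (quadratic `P` pulled back along the AFFINE frozen-point map `ptv_B^c`, plus the face's own
quadratic `c₀_B(s,t) = ⟨t,s⟩ ⊕ Q_B(s)`):
  ★ `polM_gph_apply`:  `polM (G_{P,B,c}) = polM (c₀_B) + Jᵀ·q·J + (Jᵀ·q·J)ᵀ`  ENTRYWISE,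
`J = jm B c` the `𝔽₂`-Jacobian of `ptv_B^c` (`jac`), `q = P.q` the ordered-pair coefficient table — i.e. `polM(G) = polM(c₀) ⊕ Jᵀ(q ⊕ qᵀ)J`.
The Jacobian rows are identified (`jm_vs`, `jm_vt`, `jm_vB`, `jm_vp`, `jm_vc`): `s`-rows = `[I 0]`, `t`-rows = `[0 I]`, `B`-rows = `0`, `p`-rows =
`[L 0]` with `L = Ũ` (`polar`), `c_G`-row = `0`; hence ★ `polM_gph_indep : polM (G_{P,B,true}) = polM (G_{P,B,false})` (the rank in `RankBound` /
`MatrixLemma` does not depend on `c`).  What remains of (A) on paper is only the multiplication of these blocks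
(`Jᵀ(q⊕qᵀ)J` restricted to `s×s` `= S₀′ ⊕ ZL ⊕ LZᵀ ⊕ LΞL`, `polM(c₀_B) = [[L, I],[I, 0]]`). -/

section ChainRule

open scoped Matrix

variable {ι : Type} [Fintype ι]

/-- four-point identity for a quadratic polynomial at points with `y₄ = y₁ + y₂ + y₃` coordinatewise (over `𝔽₂`):
the second difference is the symmetrised bilinear form in the LINEAR parts `α + γ`, `β + γ`. -/
theorem QuadP.ev_four (P : QuadP ι) (y₁ y₂ y₃ y₄ : ι → Bool) (α β γ : ι → ZMod 2)
    (h₁ : ∀ u, bit (y₁ u) = α u) (h₂ : ∀ u, bit (y₂ u) = β u) (h₃ : ∀ u, bit (y₃ u) = γ u)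
    (h₄ : ∀ u, bit (y₄ u) = α u + β u + γ u) :
    P.ev y₄ + P.ev y₁ + (P.ev y₂ + P.ev y₃)
      = ∑ u, ∑ v, P.q u v * ((α u + γ u) * (β v + γ v) + (β u + γ u) * (α v + γ v)) := by
  have two := Literature.Computability.QuantumComplexity.QuadPolar.two_eq_zero
  simp only [QuadP.ev, h₁, h₂, h₃, h₄]
  have hl : ∀ u, P.l u * (α u + β u + γ u) = P.l u * α u + P.l u * β u + P.l u * γ u := fun u => by ring
  have hq : ∀ u v, P.q u v * ((α u + β u + γ u) * (α v + β v + γ v))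
      = P.q u v * ((α u + γ u) * (β v + γ v) + (β u + γ u) * (α v + γ v))
        + (P.q u v * (α u * α v) + P.q u v * (β u * β v) - P.q u v * (γ u * γ v)) := fun u v => by ring
  simp only [hl, hq, sum_add_distrib, sum_sub_distrib]
  generalize (∑ u, P.l u * α u) = A
  generalize (∑ u, P.l u * β u) = A'
  generalize (∑ u, P.l u * γ u) = A''
  generalize (∑ u, ∑ v, P.q u v * (α u * α v)) = X
  generalize (∑ u, ∑ v, P.q u v * (β u * β v)) = X'
  generalize (∑ u, ∑ v, P.q u v * (γ u * γ v)) = X''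
  generalize (∑ u, ∑ v, P.q u v * ((α u + γ u) * (β v + γ v) + (β u + γ u) * (α v + γ v))) = Y
  generalize P.c = c
  revert A A' A'' X X' X'' Y c
  decide

variable {n : ℕ}

/-- the `𝔽₂`-Jacobian column at `x` of a Boolean map `A` (linear part of an affine map: `A x + A 0`) -/
def jac (A : (Fin n → Bool) → ι → Bool) (x : Fin n → Bool) (u : ι) : ZMod 2 := bit (A x u) + bit (A zeroVec u)

/-- ★ CHAIN RULE (functions): the second difference of `P ∘ A`, `A` affine, is the symmetrised form `q(Jx, Jh) + q(Jh, Jx)`. -/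
theorem dZ_ev_aff (P : QuadP ι) (A : (Fin n → Bool) → ι → Bool) (hA : ∀ u, IsAffZ (fun x => bit (A x u)))
    (h x : Fin n → Bool) :
    dZ (fun x => P.ev (A x)) h x = ∑ u, ∑ v, P.q u v * (jac A x u * jac A h v + jac A h u * jac A x v) := by
  have two := Literature.Computability.QuantumComplexity.QuadPolar.two_eq_zero
  unfold dZ
  rw [QuadP.ev_four P (A x) (A h) (A zeroVec) (A (bxor x h)) (fun u => bit (A x u)) (fun u => bit (A h u))
    (fun u => bit (A zeroVec u)) (fun _ => rfl) (fun _ => rfl) (fun _ => rfl) (fun u => hA u x h)]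
  rfl

variable {m : ℕ}

/-- the Jacobian of the frozen-point map `ptv_B^c` as a matrix `(CVar m) × (2m)` over `𝔽₂` -/
def jm (B : Fin m → Fin m → Bool) (c : Bool) : Matrix (CVar m) (Fin (m + m)) (ZMod 2) :=
  fun u i => jac (ptv B c) (ofZ (Pi.single i 1)) u

/-- PerceptronDialLawsF helper `bit_gph` (decomp-qadv land package; see the module docstring). -/
theorem bit_gph (P : QuadP (CVar m)) (B : Fin m → Fin m → Bool) (c : Bool) (x : Fin (m + m) → Bool) :
    bit (gph P B c x) = bit (c0 B x) + P.ev (ptv B c x) := by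
  rw [gph, bit_xor, bit_unbit]

/-- PerceptronDialLawsF helper `bit_diff2_eq_dZ` (decomp-qadv land package; see the module docstring). -/
theorem bit_diff2_eq_dZ (Q : (Fin n → Bool) → Bool) (h x : Fin n → Bool) :
    bit (diff2 Q h x) = dZ (fun x => bit (Q x)) h x := by
  simp only [diff2, dZ, bit_xor]

/-- ★★ CHAIN RULE (matrices, entrywise): `polM (G_{P,B,c}) = polM (c₀_B) + Jᵀ q J + (Jᵀ q J)ᵀ`. -/
theorem polM_gph_apply (P : QuadP (CVar m)) (B : Fin m → Fin m → Bool) (c : Bool) (i j : Fin (m + m)) :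
    polM (gph P B c) i j = polM (c0 B) i j
      + ∑ u, ∑ v, P.q u v * (jm B c u i * jm B c v j + jm B c u j * jm B c v i) := by
  rw [polM_apply, polM_apply, bit_diff2_eq_dZ, bit_diff2_eq_dZ]
  have e : dZ (fun x => bit (gph P B c x)) (ofZ (Pi.single i 1)) (ofZ (Pi.single j 1))
      = dZ (fun x => bit (c0 B x)) (ofZ (Pi.single i 1)) (ofZ (Pi.single j 1))
        + dZ (fun x => P.ev (ptv B c x)) (ofZ (Pi.single i 1)) (ofZ (Pi.single j 1)) := by
    simp only [dZ, bit_gph]; ring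
  rw [e, dZ_ev_aff P (ptv B c) (isAffZ_ptv B c)]
  simp only [jm]
  congr 1
  exact sum_congr rfl fun u _ => sum_congr rfl fun v _ => by ring

/-- the same in matrix form -/
theorem polM_gph (P : QuadP (CVar m)) (B : Fin m → Fin m → Bool) (c : Bool) :
    polM (gph P B c) = polM (c0 B) + ((jm B c)ᵀ * Matrix.of P.q * jm B c + ((jm B c)ᵀ * Matrix.of P.q * jm B c)ᵀ) := by
  ext i j
  have h : ∀ i j, ((jm B c)ᵀ * Matrix.of P.q * jm B c) i j = ∑ u, ∑ v, P.q u v * (jm B c u i * jm B c v j) := by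
    intro i j
    simp only [Matrix.mul_apply, Matrix.transpose_apply, Matrix.of_apply, sum_mul]
    rw [sum_comm]
    exact sum_congr rfl fun u _ => sum_congr rfl fun v _ => by ring
  rw [Matrix.add_apply, Matrix.add_apply, Matrix.transpose_apply, polM_gph_apply, h, h, ← sum_add_distrib]
  congr 1
  exact sum_congr rfl fun u _ => by
    rw [← sum_add_distrib]
    exact sum_congr rfl fun v _ => by ring

/-! ### the Jacobian rows (block structure of `J`) -/

open CVar

/-- PerceptronDialLawsF helper `jm_vs` (decomp-qadv land package; see the module docstring). -/
theorem jm_vs (B : Fin m → Fin m → Bool) (c : Bool) (a : Fin m) (i : Fin (m + m)) :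
    jm B c (vs a) i = Pi.single (M := fun _ => ZMod 2) i 1 (Fin.castAdd m a) := by
  show bit (unbit _) + bit (zeroVec (Fin.castAdd m a)) = _
  rw [bit_unbit]; simp [zeroVec, bit_false]

/-- PerceptronDialLawsF helper `jm_vt` (decomp-qadv land package; see the module docstring). -/
theorem jm_vt (B : Fin m → Fin m → Bool) (c : Bool) (a : Fin m) (i : Fin (m + m)) :
    jm B c (vt a) i = Pi.single (M := fun _ => ZMod 2) i 1 (Fin.natAdd m a) := by
  show bit (unbit _) + bit (zeroVec (Fin.natAdd m a)) = _
  rw [bit_unbit]; simp [zeroVec, bit_false]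

/-- PerceptronDialLawsF helper `jm_vB` (decomp-qadv land package; see the module docstring). -/
theorem jm_vB (B : Fin m → Fin m → Bool) (c : Bool) (a a' : Fin m) (i : Fin (m + m)) :
    jm B c (vB a a') i = 0 := by
  show bit (ut B a a') + bit (ut B a a') = 0
  generalize bit (ut B a a') = z; revert z; decide

/-- the `p`-rows: `J_{p_a, i} = (Ũ · s-part(eᵢ))_a` — the polar matrix `L = Ũ` of the key acting on the `s`-coordinates -/
theorem jm_vp (B : Fin m → Fin m → Bool) (c : Bool) (a : Fin m) (i : Fin (m + m)) :
    jm B c (vp a) i = bit (polar B (sOf (ofZ (Pi.single (M := fun _ => ZMod 2) i 1))) a) := by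
  show bit (polar B (sOf _) a) + bit (polar B (sOf zeroVec) a) = _
  rw [sOf_zeroVec, polar_zeroVec]
  show _ + bit false = _
  rw [bit_false, add_zero]

/-- PerceptronDialLawsF helper `jm_vc` (decomp-qadv land package; see the module docstring). -/
theorem jm_vc (B : Fin m → Fin m → Bool) (c : Bool) (i : Fin (m + m)) : jm B c vc i = 0 := by
  show bit c + bit c = 0
  generalize bit c = z; revert z; decide

/-- the Jacobian does not depend on the frozen value `c` -/
theorem jm_indep (B : Fin m → Fin m → Bool) : jm B true = jm B false := by
  ext u i
  rcases u with a | a | aa | a | u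
  · exact (jm_vs B true a i).trans (jm_vs B false a i).symm
  · exact (jm_vt B true a i).trans (jm_vt B false a i).symm
  · exact (jm_vB B true aa.1 aa.2 i).trans (jm_vB B false aa.1 aa.2 i).symm
  · exact (jm_vp B true a i).trans (jm_vp B false a i).symm
  · exact (jm_vc B true i).trans (jm_vc B false i).symm

/-- ★ hence the polar matrix of `G_{P,B,c}` — and its rank in `RankBound` / `MatrixLemma` — is independent of `c` -/
theorem polM_gph_indep (P : QuadP (CVar m)) (B : Fin m → Fin m → Bool) :
    polM (gph P B true) = polM (gph P B false) := by
  rw [polM_gph, polM_gph, jm_indep]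

/-- so `MatrixLemma`'s inner sum over `c` is twice the `c = false` term -/
theorem sum_bool_gaussTerm (P : QuadP (CVar m)) (B : Fin m → Fin m → Bool) :
    ∑ c : Bool, (2 : ℝ) ^ (m + m) / Real.sqrt ((2 : ℝ) ^ (polM (gph P B c)).rank)
      = 2 * ((2 : ℝ) ^ (m + m) / Real.sqrt ((2 : ℝ) ^ (polM (gph P B false)).rank)) := by
  rw [Fintype.sum_bool, polM_gph_indep]; ring

end ChainRule

end Summit.QuantumAdvantage.QuantumAdvantage.Theorems.PerceptronDial
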